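import Summits.ResolutionOfSingularities.ResolutionOfSingularities.Theorems.WeightedInvariantDescentReducedToIntegral
import Literature.AlgebraicGeometry.Resolution.ResolutionOfComponents
import Mathlib.FieldTheory.PurelyInseparable.PerfectClosure
import Mathlib.FieldTheory.IsPerfectClosure
import Mathlib.Algebra.CharP.IntermediateField
import Mathlib.Algebra.Algebra.ZMod
import Mathlib.FieldTheory.Finite.Basic
import HarnessLib

/-!
# Crux `PrimeFieldToPerfect` (stmt-ResolutionOfSingularities-15233), line `birth` (RESHAPE 2, cut of
# strategist line `frobenius-root-climb`): stub `stub_tower`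

Route `ResolutionOfSingularities/UniversalCells`, crux `PrimeFieldToPerfect`. The strategist's
normal form of the open kernel is the *climb* `hc`: if `M` is a perfect field of characteristic
`p` over which every integral separated finite-type scheme has a resolution, and `L ⊇ M` is a
perfect field of characteristic `p` containing an element `t` with `L` algebraic over `M(t)`,
then resolution holds over `L`. THIS stub is the bookkeeping statement that finitely generated
fields are reached from `𝔽_p` by finitely many climbs.

**Statement (`stub_tower`).** Let `p` be a prime; assume resolution of integral separated
finite-type schemes over `Spec (ZMod p)` (`h₀`) and the climb (`hc`). Let `K` be a field of
characteristic `p`, finitely generated as a field (`Subfield.closure s = ⊤`, `s` finite), and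
`L ⊇ K` a perfect field, purely inseparable over `K`. Then every integral `X → Spec L` which is
separated, locally of finite type and quasi-compact admits a resolution of singularities.

**Proof.** Work inside `L`, an `𝔽_p = ZMod p`-algebra. For a finite `S ⊆ L` let
`pc(S) = {x ∈ L | ∃ n, x ^ (p ^ n) ∈ 𝔽_p(S)}`, the perfect closure inside `L` of the subfield
generated by `S` (`perfectClosure`, `tower_exists_forall_mem_iff`); it is a perfect subfield
since `L` is perfect (`tower_perfectField_of_forall_mem_iff`). By induction on `S` we prove
resolution over `pc(S)`; every step, including the base case and the final passage to `L`, is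
one application of `hc`, whose algebraicity hypothesis is checked through
`tower_isAlgebraic_of_forall_pow_mem`: if every element of `N` has a positive power in the
intermediate field `A`, then `N / A` is algebraic (indeed integral, `IsIntegral.of_pow`).
* `S = ∅`: climb from `M = ZMod p` (`h₀`) to `pc(∅)` with `t = 0`: every `x ∈ pc(∅)` has
  `x ^ (p ^ n) ∈ 𝔽_p(∅) = ⊥`, the image of `ZMod p`.
* `S ↦ insert t S`: climb from `M = pc(S)` (induction hypothesis) to `pc(insert t S) ∋ t`:
  every `x ∈ pc(insert t S)` has `x ^ (p ^ n) ∈ 𝔽_p(insert t S) ⊆ M(t)`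
  (`tower_mem_adjoin_simple_of_mem_adjoin_insert`: `𝔽_p(insert t S)` is the subfield closure of
  `im 𝔽_p ∪ insert t S`, all of which lies in the image of `M(t)` in `L`).
* Finally, with `S` the image of `s` in `L`, climb from `pc(S)` to `L` (with `t = 0`): every
  `x ∈ L` has `x ^ (p ^ n) = algebraMap K L k` (`IsPurelyInseparable.pow_mem`), and
  `algebraMap K L` maps `K = closure s` into `𝔽_p(S) ⊆ pc(S)` (`Subfield.closure_le`).

Sources: the reduction of resolution problems over perfect fields to finitely generated fields
and their perfect closures is folklore (e.g. Kollár, *Lectures on Resolution of Singularities*,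
2007, Ch. 3); the field theory used (`perfectClosure`, `IsPurelyInseparable.pow_mem`) is
Mathlib's. [folklore]
-/

noncomputable section

set_option linter.dupNamespace false -- mandated namespace of this single-conjunct summit

open CategoryTheory CategoryTheory.Limits AlgebraicGeometry TopologicalSpace
open Literature.AlgebraicGeometry.Resolution

namespace Summit.ResolutionOfSingularities.ResolutionOfSingularities.Theorems.PrimeFieldToPerfect

universe u

/-- If every element of a field extension `N / M` has a positive power lying in an intermediate
field `A`, then `N` is algebraic over `A`: `x ^ n = a ∈ A` makes `x` a root of the monic
polynomial `T ^ n - a`, hence integral (`IsIntegral.of_pow`). [folklore] -/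
theorem tower_isAlgebraic_of_forall_pow_mem {M N : Type*} [Field M] [Field N] [Algebra M N]
    (A : IntermediateField M N) (h : ∀ x : N, ∃ n : ℕ, 0 < n ∧ x ^ n ∈ A) :
    Algebra.IsAlgebraic A N := by
  refine ⟨fun x => ?_⟩
  obtain ⟨n, hn, hx⟩ := h x
  have hint : IsIntegral A (x ^ n) := by
    have : x ^ n = algebraMap A N ⟨x ^ n, hx⟩ := rfl
    rw [this]
    exact isIntegral_algebraMap
  exact (IsIntegral.of_pow hn hint).isAlgebraic

/-- Let `L` be a perfect field of characteristic `p` and `M ⊆ L` an intermediate field which is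
the "`p`-radical closure" of another one `E`, i.e. `x ∈ M ↔ ∃ n, x ^ (p ^ n) ∈ E`. Then `M` is a
perfect field: the `p`-th root in `L` of an element of `M` again lies in `M`, so the Frobenius of
`M` is surjective (`PerfectRing.ofSurjective`, `PerfectRing.toPerfectField`). [folklore] -/
theorem tower_perfectField_of_forall_mem_iff (p : ℕ) [Fact p.Prime] {F L : Type*} [Field F]
    [Field L] [Algebra F L] [CharP L p] [PerfectField L] {M E : IntermediateField F L}
    (hM : ∀ x : L, x ∈ M ↔ ∃ n : ℕ, x ^ p ^ n ∈ E) : PerfectField M := by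
  haveI : PerfectRing M p := PerfectRing.ofSurjective _ p fun x => by
    obtain ⟨y, hy⟩ := surjective_frobenius L p x.1
    obtain ⟨n, hn⟩ := (hM x.1).1 x.2
    rw [frobenius_def] at hy
    have hyM : y ∈ M := (hM y).2 ⟨n + 1, by rwa [pow_succ', pow_mul, hy]⟩
    exact ⟨⟨y, hyM⟩, Subtype.ext (by rw [frobenius_def, SubmonoidClass.mk_pow]; exact hy)⟩
  exact PerfectRing.toPerfectField M p

/-- For an intermediate field `E` of `L / F` with `char F = p` prime, the `p`-radical closure
`{x ∈ L | ∃ n, x ^ (p ^ n) ∈ E}` of `E` inside `L` is an intermediate field of `L / F`: it is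
Mathlib's relative perfect closure `perfectClosure E L`, with scalars restricted to `F`
(`mem_perfectClosure_iff_pow_mem`). [folklore] -/
theorem tower_exists_forall_mem_iff (p : ℕ) [Fact p.Prime] {F L : Type*} [Field F] [Field L]
    [Algebra F L] [CharP F p] (E : IntermediateField F L) :
    ∃ M : IntermediateField F L, ∀ x : L, x ∈ M ↔ ∃ n : ℕ, x ^ p ^ n ∈ E := by
  refine ⟨(perfectClosure E L).restrictScalars F, fun x => ?_⟩
  rw [IntermediateField.mem_restrictScalars, mem_perfectClosure_iff_pow_mem p]
  constructor
  · rintro ⟨n, y, hy⟩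
    exact ⟨n, hy ▸ y.2⟩
  · rintro ⟨n, hn⟩
    exact ⟨n, ⟨x ^ p ^ n, hn⟩, rfl⟩

/-- Comparison of adjunctions along a tower of intermediate fields `M' ⊆ M` of `L / F` (the
algebra structure `M' → M` being the inclusion, `hcomp`): if `S ⊆ M'` and `t ∈ M`, then every
element of `M` lying in `F(insert t S)` (adjunction inside `L`) lies in `M'(t)` (adjunction
inside `M`). Indeed `F(insert t S)` is the subfield closure of `im F ∪ insert t S`
(`IntermediateField.adjoin_toSubfield`), and each of these generators lies in the image of
`M'(t)` in `L`, a subfield (`Subfield.closure_le`). [folklore] -/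
theorem tower_mem_adjoin_simple_of_mem_adjoin_insert {F L : Type*} [Field F] [Field L]
    [Algebra F L] (S : Set L) (t : L) (M' M : IntermediateField F L) [Algebra M' M]
    (hcomp : ∀ y : M', ((algebraMap M' M y : M) : L) = y) (hS : S ⊆ M') (ht : t ∈ M) (y : M)
    (hy : (y : L) ∈ IntermediateField.adjoin F (insert t S)) :
    y ∈ IntermediateField.adjoin M' {(⟨t, ht⟩ : M)} := by
  set A : IntermediateField M' M := IntermediateField.adjoin M' {(⟨t, ht⟩ : M)} with hA
  have hle : Subfield.closure (Set.range (algebraMap F L) ∪ insert t S) ≤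
      A.toSubfield.map (algebraMap M L) := by
    refine Subfield.closure_le.mpr ?_
    have hM' : ∀ z : L, z ∈ M' → z ∈ (A.toSubfield.map (algebraMap M L) : Set L) := by
      intro z hz
      exact ⟨algebraMap M' M ⟨z, hz⟩, A.algebraMap_mem _, hcomp ⟨z, hz⟩⟩
    rintro z (⟨c, rfl⟩ | rfl | hz)
    · exact hM' _ (M'.algebraMap_mem c)
    · exact ⟨⟨z, ht⟩, IntermediateField.mem_adjoin_simple_self M' _, rfl⟩
    · exact hM' _ (hS hz)
  rw [← IntermediateField.mem_toSubfield, IntermediateField.adjoin_toSubfield] at hy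
  obtain ⟨a, ha, hay⟩ := Subfield.mem_map.1 (hle hy)
  have : a = y := (algebraMap M L).injective hay
  exact this ▸ ha

/-- **Tower of climbs** (stub `stub_tower` of crux `PrimeFieldToPerfect`, strategist line
`frobenius-root-climb`). Assume resolution of integral separated finite-type schemes over
`Spec (ZMod p)` (`h₀`) and the *climb* `hc` (resolution over a perfect `M` of characteristic `p`
passes to every perfect `L ⊇ M` of characteristic `p` algebraic over `M(t)` for some `t ∈ L`).
Then resolution holds for integral separated finite-type (quasi-compact, locally of finite type)
schemes over every perfect field `L` purely inseparable over a finitely generated field `K` of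
characteristic `p`. Proof: inside `L`, induct on a finite set `S ⊆ L` to get resolution over the
perfect subfield `pc(S) = {x | ∃ n, x ^ (p ^ n) ∈ 𝔽_p(S)}` — base `pc(∅) ⊇ im (ZMod p)` and step
`pc(S) ⊆ pc(insert t S)` are climbs (`x ^ (p ^ n) ∈ 𝔽_p(insert t S) ⊆ pc(S)(t)`); finally climb
from `pc(im s)` to `L`, as `x ^ (p ^ n) ∈ im K ⊆ 𝔽_p(im s)` for every `x ∈ L`
(`IsPurelyInseparable.pow_mem`, `K = Subfield.closure s`). [folklore] -/
theorem stub_tower (p : ℕ) (hp : p.Prime) (h₀ : ∀ (X : Scheme.{0}) (f : X ⟶ Spec (.of (ZMod p))), IsSeparated f → LocallyOfFiniteType f → QuasiCompact f → IsIntegral X → Scheme.HasResolution X) (hc : ∀ (M : Type) [Field M] [CharP M p] [PerfectField M], (∀ (X : Scheme.{0}) (f : X ⟶ Spec (.of M)), IsSeparated f → LocallyOfFiniteType f → QuasiCompact f → IsIntegral X → Scheme.HasResolution X) → ∀ (L : Type) [Field L] [CharP L p] [PerfectField L] [Algebra M L] (t : L), Algebra.IsAlgebraic (IntermediateField.adjoin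 M ({t} : Set L)) L → ∀ (X : Scheme.{0}) (f : X ⟶ Spec (.of L)), IsSeparated f → LocallyOfFiniteType f → QuasiCompact f → IsIntegral X → Scheme.HasResolution X) (K : Type) [Field K] [CharP K p] (hK : ∃ s : Finset K, Subfield.closure (s : Set K) = ⊤) (L : Type) [Field L] [PerfectField L] [Algebra K L] [IsPurelyInseparable K L] (X : Scheme.{0}) (f : X ⟶ Spec (.of L)) (hs : IsSeparated f) (hl : LocallyOfFiniteType f) (hq : QuasiCompact f) (hX : IsIntegral X) : Scheme.HasResolution X := by
  classical
  haveI : Fact p.Prime := ⟨hp⟩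
  haveI : CharP L p := charP_of_injective_algebraMap (algebraMap K L).injective p
  letI : Algebra (ZMod p) L := ZMod.algebra L p
  -- ### Resolution over the perfect subfields `pc(S)`, by induction on the finite set `S ⊆ L`
  have key : ∀ (S : Finset L) (M : IntermediateField (ZMod p) L),
      (∀ x : L, x ∈ M ↔ ∃ n : ℕ, x ^ p ^ n ∈ IntermediateField.adjoin (ZMod p) (↑S : Set L)) →
      ∀ (Y : Scheme.{0}) (g : Y ⟶ Spec (.of M)), IsSeparated g → LocallyOfFiniteType g →
        QuasiCompact g → IsIntegral Y → Scheme.HasResolution Y := by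
    intro S
    induction S using Finset.induction_on with
    | empty =>
      -- climb from `ZMod p` to `pc(∅)` (with `t = 0`)
      intro M hM
      haveI : PerfectField M := tower_perfectField_of_forall_mem_iff p hM
      refine hc (ZMod p) h₀ M (0 : M) (tower_isAlgebraic_of_forall_pow_mem _ fun x => ?_)
      obtain ⟨n, hn⟩ := (hM x.1).1 x.2
      rw [Finset.coe_empty, IntermediateField.adjoin_empty, IntermediateField.mem_bot] at hn
      obtain ⟨c, hc'⟩ := hn
      refine ⟨p ^ n, pow_pos hp.pos n, ?_⟩
      have hx : x ^ p ^ n = algebraMap (ZMod p) M c := Subtype.ext (by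
        rw [IntermediateField.coe_algebraMap_apply, hc']; rfl)
      rw [hx]
      exact IntermediateField.algebraMap_mem _ c
    | insert t S _ ih =>
      -- climb from `pc(S)` to `pc(insert t S)` (with `t = t`)
      intro M hM
      obtain ⟨M', hM'⟩ :=
        tower_exists_forall_mem_iff p (IntermediateField.adjoin (ZMod p) (↑S : Set L))
      have hres' := ih M' hM'
      have hSM' : (↑S : Set L) ⊆ M' := fun x hx =>
        (hM' x).2 ⟨0, by simpa using IntermediateField.subset_adjoin _ _ hx⟩
      have hle : M' ≤ M := fun x hx => by
        obtain ⟨n, hn⟩ := (hM' x).1 hx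
        refine (hM x).2 ⟨n, IntermediateField.adjoin.mono _ _ _ ?_ hn⟩
        rw [Finset.coe_insert]
        exact Set.subset_insert _ _
      have ht : t ∈ M := (hM t).2 ⟨0, by
        simpa using IntermediateField.subset_adjoin _ _ (Set.mem_insert t (↑S : Set L))⟩
      haveI : PerfectField M' := tower_perfectField_of_forall_mem_iff p hM'
      haveI : PerfectField M := tower_perfectField_of_forall_mem_iff p hM
      letI : Algebra M' M := (IntermediateField.inclusion hle).toRingHom.toAlgebra
      refine hc M' hres' M ⟨t, ht⟩ (tower_isAlgebraic_of_forall_pow_mem _ fun x => ?_)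
      obtain ⟨n, hn⟩ := (hM x.1).1 x.2
      refine ⟨p ^ n, pow_pos hp.pos n, ?_⟩
      refine tower_mem_adjoin_simple_of_mem_adjoin_insert (↑S : Set L) t M' M (fun y => rfl)
        hSM' ht (x ^ p ^ n) ?_
      rw [Finset.coe_insert] at hn
      simpa using hn
  -- ### The last climb: from `pc(S)`, `S` the image of the generators `s` of `K`, to `L`
  obtain ⟨s, hsK⟩ := hK
  obtain ⟨M₀, hM₀⟩ := tower_exists_forall_mem_iff p
    (IntermediateField.adjoin (ZMod p) (↑(s.image (algebraMap K L)) : Set L))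
  have hres₀ := key _ M₀ hM₀
  haveI : PerfectField M₀ := tower_perfectField_of_forall_mem_iff p hM₀
  refine hc M₀ hres₀ L (0 : L) (tower_isAlgebraic_of_forall_pow_mem _ fun x => ?_) X f hs hl hq hX
  obtain ⟨n, k, hk⟩ := IsPurelyInseparable.pow_mem K p x
  refine ⟨p ^ n, pow_pos hp.pos n, ?_⟩
  have hkM : algebraMap K L k ∈ M₀ := by
    refine (hM₀ _).2 ⟨0, ?_⟩
    rw [pow_zero, pow_one]
    have hk' : k ∈ Subfield.closure (↑s : Set K) := by
      rw [hsK]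
      exact Subfield.mem_top k
    have hcl : Subfield.closure (↑s : Set K) ≤
        (IntermediateField.adjoin (ZMod p) (↑(s.image (algebraMap K L)) : Set L)).toSubfield.comap
          (algebraMap K L) :=
      Subfield.closure_le.mpr fun a ha => by
        rw [SetLike.mem_coe, Subfield.mem_comap, IntermediateField.mem_toSubfield]
        refine IntermediateField.subset_adjoin _ _ ?_
        rw [Finset.coe_image]
        exact Set.mem_image_of_mem _ ha
    have := hcl hk'
    rwa [Subfield.mem_comap, IntermediateField.mem_toSubfield] at this
  rw [← hk, show algebraMap K L k = algebraMap M₀ L ⟨_, hkM⟩ from rfl]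
  exact IntermediateField.algebraMap_mem _ _

end Summit.ResolutionOfSingularities.ResolutionOfSingularities.Theorems.PrimeFieldToPerfect

end
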